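import Summits.AnomalousDissipation.AnomalousDissipation.Theorems.GalerkinSteadyZerothLaw.Negative.StokesStates
import Literature.Analysis.FluidPDE.NSGalerkinStationary
import Literature.Analysis.FluidPDE.TwoHalfNavierStokes
import Summits.AnomalousDissipation.AnomalousDissipation.Theorems.TwoAndHalfDTwohalfdNegCertificate

/-!
# Strategist census s1 (typed part) — crux `MirrorVariety.GalerkinSteadyZerothLaw` (stmt-AnomalousDissipation-2986)

Author: planner-cstrat-stmt-AnomalousDissipation-2986-s1-0 (crux-strategist gen 1, re-arm "cone changed", 2026-08-16/17).
Companion of `STRATEGY-CENSUS.md` v2 (§N5, §S5).  Two typed census facts, no new line.  (The two `Lines/*.lean` workfiles are not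
importable on the farm, so the five definitions of `Lines/planar_carrier_dirichlet.lean` §0–§1 and the registered heart signature of
`Lines/idea_sketch_ideator2.lean` are restated VERBATIM below — `Iff.rfl` with the originals.)

**§A (Negation N5 — the registered alternative line `planar-carrier-dirichlet` is conditionally dead).**
Its heart `BranchingCarriers` produces, through the line's own `Lift25` + `DirichletBound`, an `x₃`-INVARIANT smooth force
`twoHalf g s` with `x₃`-invariant loud bounded Galerkin steady states along `ν_j → 0` at frequently many `N`.  Realised as
constant-path Leray–Hopf families (hypothesis `InvariantSteadyRealisation` = the `x₃`-invariant twin of the LANDED route supports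
`FixedViscosityTransfer` ∘ `SteadyWeakIsGlobalLerayHopf`, stmt-2991/2992; the only extra content is that the subsequence limit of
invariant fields is invariant and that the constant path keeps a pointwise-invariant representative), they contradict the sibling
crux `TwoAndHalfD.TwohalfdNeg` (stmt-AnomalousDissipation-0211).  Hence, sorry-free below:
* `not_planarWitness` — for ONE planar pair `(g, s)`: the force-wise negation `NegFor (twoHalf g s)` kills every planar witness;
* `not_branchingCarriers` — `TwohalfdNeg → ¬ BranchingCarriers`;
* `not_branchingCarriers_of_subLogStrain` — with the LANDED certificate `Certificate.twohalfdNeg_of_subLogStrain`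
  (2026-08-16): the planar law `SubLogStrain` (`⟨‖∇v_j‖₂⟩/log(1/ν_j) → 0` for every bounded-energy steadily forced planar
  Leray–Hopf family) already kills the line;
* `not_planarWitness_singleShell` — UNCONDITIONALLY (landed `Certificate.twohalfdNeg_twoHalf_singleShell`, Tran–Shepherd):
  no planar witness whose carrier force `g` lives on one shell `|k|² = m`, whatever the source `s`.
So the line survives only with a multi-shell `g`, a source outside `ℝ·curl g` (landed `Coscalar`/`ZeroSource`/`VerticalForce`
sub-cases of 0211, not re-typed here) and carriers of at least logarithmic mean strain — on top of the three bets already in its card.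

**§B (Strengthen S5 — "sector hopping", typed and shown to be a sub-heart of the live line).**  `SectorCoatWindows`: ONE core and a
FIXED clamp bracket `[a, b]` rescaled by `m⁻²`, such that for infinitely many vertical wavenumbers `m`, frequently in `N`, the
`m`-sector (coats whose Fourier support has `m ∣ k₃`) carries a connected loud bounded coat family over `[a/m², b/m²]`.  It implies
the lead's registered heart `LoudCoatDecades` (`loudCoatDecades_of_sectorCoatWindows`, sorry-free: `νlo_j := a/m_j²`,
`ρ := b/a`) — one generation per viscosity, the generation index `m → ∞` supplying `ν → 0`, no branch followed over more than the
fixed factor `b/a`.  WHY IT IS NOT REGISTERED AS A LINE (census §S5): in the columnar limit `m → ∞` (clamp `ν = ν̃/m²`) the rung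
problem over a single-shell planar core `C` is the pressureless transport operator `a ↦ (C·∇)a + (a·∇)C` on `L²(T²; ℝ²)` damped by
`ν̃(2πn)²` (Bayly 1988 / Sipp–Jacquin 2000 vertical-wavevector short waves); on the convex single-signed cells of a one-shell stream
function the Sipp–Jacquin discriminant `2(V/R)ω` is positive, so real growth lives only on the separatrix web (hyperbolic
stagnation lines, rate = strain), the neutral modes concentrate there with width `(ν/σ)^{1/2}`, and the saturated coats are one
generation of strained tubes/sheets — log-loud at bounded energy (judge key risk; census 2987).  The typed statement is left for a
future ideator who finds an admissible core with volume-filling short-wave growth AND a global phase.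
-/

noncomputable section

set_option linter.dupNamespace false

open scoped InnerProductSpace Topology
open MeasureTheory Filter Set UnitAddTorus
open Literature.Analysis.FunctionSpaces Literature.Analysis.FunctionSpaces.Torus
open Literature.Analysis.FluidPDE Literature.Analysis.FluidPDE.Torus

namespace Summit.AnomalousDissipation.AnomalousDissipation.Cruxes.GalerkinSteadyZerothLaw.StrategistS1

open Summit.AnomalousDissipation.AnomalousDissipation.Theorems.GalerkinSteadyZerothLaw.Negative (SteadyState)
open Summit.AnomalousDissipation.AnomalousDissipation.Theorems.LaminarNeverLoud.Negative (modes energy dissipation)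
open Summit.AnomalousDissipation.AnomalousDissipation.Theses.TwoAndHalfD (TwohalfdNeg)
open Summit.AnomalousDissipation.AnomalousDissipation.Theorems.TwohalfdNeg

/-- The flat two-torus (local notation). -/
local notation "𝕋²" => UnitAddTorus (Fin 2)
/-- The flat three-torus (local notation). -/
local notation "𝕋³" => UnitAddTorus (Fin 3)
/-- Planar velocity values (local notation). -/
local notation "E²" => EuclideanSpace ℝ (Fin 2)
/-- Velocity values (local notation). -/
local notation "E³" => EuclideanSpace ℝ (Fin 3)

/-! ## §0  Verbatim copies (planar line `Lines/planar_carrier_dirichlet.lean` §0–§1) -/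

/-- [verbatim copy] Band-limitation of a real planar scalar to the punctured frequency ball. -/
def ScalarBandLimited (N : ℕ) (θ : 𝕋² → ℝ) : Prop :=
  ∀ k ∉ (freqBall N).erase (0 : Fin 2 → ℤ), mFourierCoeff (fun x => (θ x : ℂ)) k = 0

/-- [verbatim copy] Steady Galerkin sourced scalar in tested form at `(ν, N)`. -/
def SteadyScalar (ν : ℝ) (N : ℕ) (u : 𝕋² → E²) (s θ : 𝕋² → ℝ) : Prop :=
  IsSmooth θ ∧ ScalarBandLimited N θ ∧
    ∀ ψ : 𝕋² → ℝ, IsSmooth ψ → ScalarBandLimited N ψ →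
      ∫ x, (θ x * convect u ψ x + ν * (θ x * laplacian ψ x) + s x * ψ x) = 0

/-- [verbatim copy] Dirichlet test pair (loudness certificate) of size `ε`. -/
def LoudnessCertificate (ν ε : ℝ) (N : ℕ) (u : 𝕋² → E²) (s : 𝕋² → ℝ) : Prop :=
  ∃ (φ : 𝕋² → ℝ) (F : 𝕋² → E²), IsSmooth φ ∧ ScalarBandLimited N φ ∧ IsSmooth F ∧
    (∀ x, divergence F x = convect u φ x) ∧
    ε ≤ 2 * (∫ x, s x * φ x) - ν * scalarGradNormSq φ - ν⁻¹ * ∫ x, ‖F x‖ ^ 2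

/-- [verbatim copy] Stub 1 statement of the planar line — the nonreversible Dirichlet floor. -/
def DirichletBound : Prop :=
  ∀ (ν ε : ℝ) (N : ℕ) (u : 𝕋² → E²) (s θ : 𝕋² → ℝ),
    0 < ν → IsSmooth u → IsDivFree u → Continuous s →
    SteadyScalar ν N u s θ → LoudnessCertificate ν ε N u s → ε ≤ ν * scalarGradNormSq θ

/-- [verbatim copy] Stub 2 statement of the planar line — the `x₃`-invariant Galerkin lift. -/
def Lift25 : Prop :=
  ∀ (ν : ℝ) (N : ℕ) (g u : 𝕋² → E²) (s θ : 𝕋² → ℝ),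
    IsSmooth g → IsDivFree g → HasZeroMean g → IsSmooth s → HasZeroMean s →
    SteadyState ν N g u → SteadyScalar ν N u s θ →
    IsSmooth (twoHalf g s) ∧ IsDivFree (twoHalf g s) ∧ HasZeroMean (twoHalf g s) ∧
      SteadyState ν N (twoHalf g s) (twoHalf u θ) ∧
      ∫ x, ‖twoHalf u θ x‖ ^ 2 = (∫ y, ‖u y‖ ^ 2) + ∫ y, θ y ^ 2 ∧
      gradNormSq (twoHalf u θ) = gradNormSq u + scalarGradNormSq θ

/-- [verbatim copy] Stub 3 statement of the planar line — THE HEART `BranchingCarriers`. -/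
def BranchingCarriers : Prop :=
  ∃ (g : 𝕋² → E²) (s : 𝕋² → ℝ), IsSmooth g ∧ IsDivFree g ∧ HasZeroMean g ∧ IsSmooth s ∧ HasZeroMean s ∧
    ∃ (ν : ℕ → ℝ) (E₁ E₂ ε : ℝ), (∀ j, 0 < ν j) ∧ Tendsto ν atTop (𝓝 0) ∧ 0 < ε ∧
      ∀ j, ∃ᶠ N in atTop, ∃ (u : 𝕋² → E²) (θ : 𝕋² → ℝ),
        SteadyState (ν j) N g u ∧ ∫ x, ‖u x‖ ^ 2 ≤ E₁ ∧
        SteadyScalar (ν j) N u s θ ∧ ∫ x, θ x ^ 2 ≤ E₂ ∧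
        LoudnessCertificate (ν j) ε N u s

/-! ## §A  The planar line against `TwohalfdNeg` -/

/-- Invariance under the translations along the third axis (verbatim the clause of `TwohalfdNeg`). -/
def IsAxial (U : 𝕋³ → E³) : Prop :=
  ∀ (s : UnitAddCircle) (x : 𝕋³), U (x + Pi.single (2 : Fin 3) s) = U x

/-- `2½`-dimensional lifts are axial. [folklore] -/
theorem isAxial_twoHalf (V : 𝕋² → E²) (R : 𝕋² → ℝ) : IsAxial (twoHalf V R) := by
  intro s x
  rw [twoHalf_eq_comp, Function.comp_apply, Function.comp_apply]
  exact comp_planarProj_add_single (fun y => planarEmbed (V y, R y)) s x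

/-- **Hypothesis (the missing glue, M–L; not an item).**  The `x₃`-invariant twin of the landed route supports
`FixedViscosityTransfer` (stmt-2991) ∘ `SteadyWeakIsGlobalLerayHopf` (stmt-2992): at a fixed viscosity, axial loud bounded
tested-Galerkin steady states of an axial admissible force at infinitely many resolutions are realised by an axial global
Leray–Hopf path (the constant path of an axial steady weak solution extracted along `N`) with `limsup`-mean energy `≤ E` and
`limsup`-mean dissipation `≥ ε` (energy EQUATION of the steady limit).  Extra content over the landed pair: the strong `L²`
subsequence limit of axial fields has an axial representative, and so does the constant path. -/
def InvariantSteadyRealisation : Prop :=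
  ∀ (ν E ε : ℝ) (f : 𝕋³ → E³), 0 < ν → IsSmooth f → IsDivFree f → HasZeroMean f → IsAxial f →
    (∃ᶠ N in atTop, ∃ U : 𝕋³ → E³,
        IsAxial U ∧ SteadyState ν N f U ∧ ∫ x, ‖U x‖ ^ 2 ≤ E ∧ ε ≤ ν * gradNormSq U) →
    ∃ (u₀ : 𝕋³ → E³) (u : ℝ → 𝕋³ → E³), (∀ t, IsAxial (u t)) ∧
      IsGlobalLerayHopf ν (fun _ => f) u₀ u ∧ meanEnergy u ≤ E ∧ ε ≤ meanDissipation ν u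

/-- The witness matrix of the planar line for ONE designed pair `(g, s)` (= `BranchingCarriers` with `g, s` exposed). -/
def PlanarWitness (g : 𝕋² → E²) (s : 𝕋² → ℝ) : Prop :=
  ∃ (ν : ℕ → ℝ) (E₁ E₂ ε : ℝ), (∀ j, 0 < ν j) ∧ Tendsto ν atTop (𝓝 0) ∧ 0 < ε ∧
    ∀ j, ∃ᶠ N in atTop, ∃ (u : 𝕋² → E²) (θ : 𝕋² → ℝ),
      SteadyState (ν j) N g u ∧ ∫ x, ‖u x‖ ^ 2 ≤ E₁ ∧
      SteadyScalar (ν j) N u s θ ∧ ∫ x, θ x ^ 2 ≤ E₂ ∧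
      LoudnessCertificate (ν j) ε N u s

/-- `BranchingCarriers` is `PlanarWitness` for some admissible pair. [folklore] -/
theorem branchingCarriers_iff :
    BranchingCarriers ↔ ∃ (g : 𝕋² → E²) (s : 𝕋² → ℝ),
      IsSmooth g ∧ IsDivFree g ∧ HasZeroMean g ∧ IsSmooth s ∧ HasZeroMean s ∧ PlanarWitness g s :=
  Iff.rfl

/-- The force-wise negation: the statement of `TwohalfdNeg` for ONE axial force `f`. -/
def NegFor (f : 𝕋³ → E³) : Prop :=
  ∀ (ν : ℕ → ℝ) (u₀ : ℕ → 𝕋³ → E³) (u : ℕ → ℝ → 𝕋³ → E³),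
    (∀ j, 0 < ν j) → Tendsto ν atTop (𝓝 0) →
    (∀ j, IsGlobalLerayHopf (ν j) (fun _ => f) (u₀ j) (u j)) →
    (∀ j (t : ℝ) (s : UnitAddCircle) (x : 𝕋³), u j t (x + Pi.single (2 : Fin 3) s) = u j t x) →
    (∃ E : ℝ, ∀ j, meanEnergy (u j) ≤ E) →
    Tendsto (fun j => meanDissipation (ν j) (u j)) atTop (𝓝 0)

/-- `TwohalfdNeg` is `NegFor` of every admissible axial force. [folklore] -/
theorem negFor_of_twohalfdNeg (hNeg : TwohalfdNeg) {f : 𝕋³ → E³} (hfinv : IsAxial f) (hfs : IsSmooth f)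
    (hfd : IsDivFree f) (hfz : HasZeroMean f) : NegFor f :=
  fun ν u₀ u hν hν0 hLH huinv hE => hNeg f hfinv hfs hfd hfz ν u₀ u hν hν0 hLH huinv hE

/-- **N5, force-wise.**  Given the two provable stubs of the planar line and the invariant realisation glue, the force-wise
negation for `twoHalf g s` kills every planar witness over `(g, s)`.  Proof: lift (`Lift25`), certify loudness
(`DirichletBound`), realise as axial Leray–Hopf families with dissipation `≥ ε`, contradict `meanDissipation → 0`. -/
theorem not_planarWitness (hD : DirichletBound) (hL : Lift25) (hR : InvariantSteadyRealisation)
    {g : 𝕋² → E²} {s : 𝕋² → ℝ} (hg : IsSmooth g) (hgd : IsDivFree g) (hgm : HasZeroMean g)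
    (hs : IsSmooth s) (hsm : HasZeroMean s) (hNeg : NegFor (twoHalf g s)) : ¬ PlanarWitness g s := by
  rintro ⟨ν, E₁, E₂, ε, hν, hlim, hε, H⟩
  -- admissibility of the lifted force, read off from any one witness
  obtain ⟨N₀, u₀, θ₀, hu₀, -, hθ₀, -, -⟩ := (H 0).exists
  obtain ⟨hfs, hfd, hfm, -, -, -⟩ := hL (ν 0) N₀ g u₀ s θ₀ hg hgd hgm hs hsm hu₀ hθ₀
  have hfinv : IsAxial (twoHalf g s) := isAxial_twoHalf g s
  -- at each `j`: axial loud bounded states, frequently in `N`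
  have hfreq : ∀ j, ∃ᶠ N in atTop, ∃ U : 𝕋³ → E³, IsAxial U ∧ SteadyState (ν j) N (twoHalf g s) U ∧
      ∫ x, ‖U x‖ ^ 2 ≤ E₁ + E₂ ∧ ε ≤ ν j * gradNormSq U := by
    intro j
    refine (H j).mono fun N hN => ?_
    obtain ⟨u, θ, hu, hEu, hθ, hEθ, hcert⟩ := hN
    obtain ⟨-, -, -, hS, hE, hG⟩ := hL (ν j) N g u s θ hg hgd hgm hs hsm hu hθ
    refine ⟨twoHalf u θ, isAxial_twoHalf u θ, hS, ?_, ?_⟩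
    · rw [hE]
      linarith
    · have hd : ε ≤ ν j * scalarGradNormSq θ :=
        hD (ν j) ε N u s θ (hν j) hu.1 hu.2.1 hs.continuous hθ hcert
      have h0 : 0 ≤ ν j * gradNormSq u := mul_nonneg (hν j).le (gradNormSq_nonneg u)
      rw [hG, mul_add]
      linarith
  -- realise and contradict the force-wise negation
  choose v₀ v hvinv hvLH hvE hvε using
    fun j => hR (ν j) (E₁ + E₂) ε (twoHalf g s) (hν j) hfs hfd hfm hfinv (hfreq j)
  have hT := hNeg ν v₀ v hν hlim hvLH (fun j t s' x => hvinv j t s' x) ⟨E₁ + E₂, hvE⟩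
  obtain ⟨j, hj⟩ := (hT.eventually (gt_mem_nhds hε)).exists
  exact absurd (hvε j) (not_le.2 hj)

/-- **N5.**  `TwohalfdNeg → ¬ BranchingCarriers` (given the line's two provable stubs and the invariant realisation glue). -/
theorem not_branchingCarriers (hD : DirichletBound) (hL : Lift25) (hR : InvariantSteadyRealisation)
    (hNeg : TwohalfdNeg) : ¬ BranchingCarriers := by
  rintro ⟨g, s, hg, hgd, hgm, hs, hsm, hW⟩
  have hfinv : IsAxial (twoHalf g s) := isAxial_twoHalf g s
  have hfs : IsSmooth (twoHalf g s) := hg.twoHalf hs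
  have hfd : IsDivFree (twoHalf g s) := IsDivFree.twoHalf hgd s
  have hfz : HasZeroMean (twoHalf g s) :=
    hasZeroMean_twoHalf hg.continuous.integrable_unitAddTorus hs.continuous.integrable_unitAddTorus hgm hsm
  exact not_planarWitness hD hL hR hg hgd hgm hs hsm (negFor_of_twohalfdNeg hNeg hfinv hfs hfd hfz) hW

/-- **N5 with the landed certificate (2026-08-16).**  The planar growth law `SubLogStrain` (hypothesis `hS6`, verbatim the
registered residual stub of crux 0211) kills the planar line. -/
theorem not_branchingCarriers_of_subLogStrain (hD : DirichletBound) (hL : Lift25) (hR : InvariantSteadyRealisation)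
    (hS6 : ∀ g : UnitAddTorus (Fin 2) → EuclideanSpace ℝ (Fin 2),
      Torus.IsSmooth g → Torus.IsDivFree g → Torus.HasZeroMean g →
      ∀ (ν : ℕ → ℝ) (v₀ : ℕ → UnitAddTorus (Fin 2) → EuclideanSpace ℝ (Fin 2))
        (v : ℕ → ℝ → UnitAddTorus (Fin 2) → EuclideanSpace ℝ (Fin 2)),
        (∀ j, 0 < ν j) → Tendsto ν atTop (𝓝 0) →
        (∀ j, Torus.IsGlobalLerayHopf (ν j) (fun _ => g) (v₀ j) (v j)) →
        (∃ E : ℝ, ∀ j, meanEnergy (v j) ≤ E) →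
        Tendsto (fun j => longTimeAvgSup (fun t => Real.sqrt (Torus.eGradNormSq (v j t)).toReal) /
          Real.log (ν j)⁻¹) atTop (𝓝 0)) :
    ¬ BranchingCarriers :=
  not_branchingCarriers hD hL hR (Certificate.twohalfdNeg_of_subLogStrain hS6)

/-- **N5, unconditional sub-case (landed Tran–Shepherd certificate).**  No planar witness over a SINGLE-SHELL carrier force `g`
(Fourier support on one shell `|k|² = m`), whatever the smooth mean-zero source `s`. -/
theorem not_planarWitness_singleShell (hD : DirichletBound) (hL : Lift25) (hR : InvariantSteadyRealisation)
    {g : 𝕋² → E²} {s : 𝕋² → ℝ} (hg : IsSmooth g) (hgd : IsDivFree g) (hgm : HasZeroMean g)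
    (hs : IsSmooth s) (hsm : HasZeroMean s)
    (hshell : ∃ m : ℝ, ∀ k : Fin 2 → ℤ, freqNormSq k ≠ m → mFourierCoeff (EuclideanSpace.complexify ∘ g) k = 0) :
    ¬ PlanarWitness g s :=
  not_planarWitness hD hL hR hg hgd hgm hs hsm
    (fun ν u₀ u hν hν0 hLH huinv hE =>
      Certificate.twohalfdNeg_twoHalf_singleShell g s hg hgd hgm hs hsm hshell ν u₀ u hν hν0 hLH huinv hE)

/-! ## §B  Sector hopping, typed (a sub-heart of the live line; not registered) -/

/-- [verbatim copy] The registered heart `stub_loudCoatDecades` of the live line `idea-sketch-ideator2` (= `LoudCoatDecades`,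
stated over landed vocabulary). -/
def LoudCoatDecadesStub : Prop :=
  ∃ (K₀ : ℕ) (Cfun : (Fin 3 → ℤ) → EuclideanSpace ℂ (Fin 3)), (∀ k ∉ modes (Fin 3) K₀, Cfun k = 0) ∧
    ∃ (E₁ ε₁ M ρ : ℝ) (νlo : ℕ → ℝ), 0 < ε₁ ∧ 0 < ρ ∧ M < ρ ^ 2 * ε₁ ∧ (∀ j, 0 < νlo j) ∧
      Tendsto νlo atTop (𝓝 0) ∧
      ∀ j, ∃ᶠ N in atTop, ∃ C : ↥(modes (Fin 3) N) → EuclideanSpace ℂ (Fin 3),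
        (C = fun k : ↥(modes (Fin 3) N) => Cfun k) ∧
        (C ∈ galerkinSubspace (modes (Fin 3) N) ∧ C ≠ 0 ∧ galerkinRHS (modes (Fin 3) N) 0 0 C = 0) ∧
        ∃ K : Set (ℝ × (↥(modes (Fin 3) N) → EuclideanSpace ℂ (Fin 3))), IsConnected K ∧
          (∀ p ∈ K, (p.2 ∈ galerkinSubspace (modes (Fin 3) N) ∧ (∑ k, (inner ℂ (C k) (p.2 k)).re) = 0 ∧
              ∃ s : ℝ, galerkinRHS (modes (Fin 3) N) p.1 0 (C + p.2) = (-s) • C) ∧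
            energy (C + p.2) ≤ E₁ ∧ ε₁ ≤ dissipation p.1 (C + p.2) ∧ dissipation p.1 (C + p.2) ≤ M) ∧
          Set.Icc (νlo j) (ρ * νlo j) ⊆ Prod.fst '' K

/-- **S5 `SectorCoatWindows`.**  ONE core shape `Cfun` supported in `modes K₀`, budgets `E₁, ε₁, M`, a FIXED clamp bracket
`0 < a < b` with `M < (b/a)² ε₁`, such that for INFINITELY MANY vertical wavenumbers `m`, frequently in `N`, the restriction
`C` is an Euler core and the `m`-SECTOR (coats `h` with `ĥ(k) = 0` unless `m ∣ k₃`) carries a connected family of loud bounded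
coats whose clamp viscosities cover `[a/m², b/m²]`. -/
def SectorCoatWindows : Prop :=
  ∃ (K₀ : ℕ) (Cfun : (Fin 3 → ℤ) → EuclideanSpace ℂ (Fin 3)), (∀ k ∉ modes (Fin 3) K₀, Cfun k = 0) ∧
    ∃ (E₁ ε₁ M a b : ℝ), 0 < ε₁ ∧ 0 < a ∧ a < b ∧ M < (b / a) ^ 2 * ε₁ ∧
      ∃ᶠ m : ℕ in atTop, ∃ᶠ N in atTop, ∃ C : ↥(modes (Fin 3) N) → EuclideanSpace ℂ (Fin 3),
        (C = fun k : ↥(modes (Fin 3) N) => Cfun k) ∧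
        (C ∈ galerkinSubspace (modes (Fin 3) N) ∧ C ≠ 0 ∧ galerkinRHS (modes (Fin 3) N) 0 0 C = 0) ∧
        ∃ K : Set (ℝ × (↥(modes (Fin 3) N) → EuclideanSpace ℂ (Fin 3))), IsConnected K ∧
          (∀ p ∈ K, (p.2 ∈ galerkinSubspace (modes (Fin 3) N) ∧ (∑ k, (inner ℂ (C k) (p.2 k)).re) = 0 ∧
              ∃ s : ℝ, galerkinRHS (modes (Fin 3) N) p.1 0 (C + p.2) = (-s) • C) ∧
            (∀ k : ↥(modes (Fin 3) N), ¬ ((m : ℤ) ∣ (k : Fin 3 → ℤ) 2) → p.2 k = 0) ∧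
            energy (C + p.2) ≤ E₁ ∧ ε₁ ≤ dissipation p.1 (C + p.2) ∧ dissipation p.1 (C + p.2) ≤ M) ∧
          Set.Icc (a / (m : ℝ) ^ 2) (b / (m : ℝ) ^ 2) ⊆ Prod.fst '' K

/-- **`SectorCoatWindows → LoudCoatDecades`** (the lead's registered heart, verbatim): along a sequence `m_j → ∞` of good
wavenumbers put `νlo j := a/m_j²`, `ρ := b/a`, and forget the sector clause. [folklore] -/
theorem loudCoatDecades_of_sectorCoatWindows (h : SectorCoatWindows) : LoudCoatDecadesStub := by
  obtain ⟨K₀, Cfun, hsupp, E₁, ε₁, M, a, b, hε₁, ha, hab, hM, hfreq⟩ := h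
  obtain ⟨φ, hφmono, hφ⟩ := extraction_of_frequently_atTop hfreq
  have hb : 0 < b := ha.trans hab
  -- shift the extraction by one so that every selected wavenumber is positive (`j + 1 ≤ φ (j + 1)`)
  have hpos : ∀ j, 0 < (φ (j + 1) : ℝ) := fun j => by
    have h1 : j + 1 ≤ φ (j + 1) := hφmono.le_apply
    exact_mod_cast Nat.lt_of_lt_of_le (Nat.succ_pos j) h1
  have htop : Tendsto (fun j => (φ (j + 1) : ℝ)) atTop atTop :=
    tendsto_natCast_atTop_atTop.comp (hφmono.tendsto_atTop.comp (tendsto_add_atTop_nat 1))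
  refine ⟨K₀, Cfun, hsupp, E₁, ε₁, M, b / a, fun j => a / (φ (j + 1) : ℝ) ^ 2, hε₁, div_pos hb ha, hM,
    fun j => div_pos ha (pow_pos (hpos j) 2), ?_, fun j => ?_⟩
  · have h2 : Tendsto (fun j => ((φ (j + 1) : ℝ) ^ 2)⁻¹) atTop (𝓝 0) :=
      ((tendsto_pow_atTop two_ne_zero).comp htop).inv_tendsto_atTop
    simpa only [div_eq_mul_inv, mul_zero] using h2.const_mul a
  · refine (hφ (j + 1)).mono fun N hN => ?_
    obtain ⟨C, hCdef, hCcore, K, hKconn, hKprop, hcov⟩ := hN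
    refine ⟨C, hCdef, hCcore, K, hKconn, fun p hp => ?_, ?_⟩
    · obtain ⟨hcoat, -, hE, hlo, hhi⟩ := hKprop p hp
      exact ⟨hcoat, hE, hlo, hhi⟩
    · have ha0 : a ≠ 0 := ha.ne'
      have hx0 : (φ (j + 1) : ℝ) ^ 2 ≠ 0 := (pow_pos (hpos j) 2).ne'
      have heq : b / a * (a / (φ (j + 1) : ℝ) ^ 2) = b / (φ (j + 1) : ℝ) ^ 2 := by
        field_simp
      rw [heq]
      exact hcov

end Summit.AnomalousDissipation.AnomalousDissipation.Cruxes.GalerkinSteadyZerothLaw.StrategistS1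

end
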